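/-
Origin: expansion seat `literature-prover-pub-hodgecm-cf-kudla-howe-rallis-g4-0`, handover #2 v3 2026-08-18T07:17:42Z doc-only (`HOME/pub-hodgecm-cf-kudla-howe-rallis-g4/AlbaneseUnitaryShimura.lean`, md5 5005fc11, 223 lines);
landed by the gen-7 packager in gate run 25 REPLACES the earlier landed copy of `HodgeCM/Literature/AlbaneseUnitaryShimura.lean` (verbatim).
-/
/-
Origin: HOME/pub-hodgecm-cf-kudla-howe-rallis/AlbaneseUnitaryShimura.lean — session
literature-prover-pub-hodgecm-cf-kudla-howe-rallis-0 (unit pub-hodgecm-cf-kudla-howe-rallis, CITED-FACT seat (4)), second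
file (ADDITIONS ONLY; `ThetaCorrespondence.lean` is untouched).  Intended final place:
`HodgeCM/Literature/AlbaneseUnitaryShimura.lean` (imports `Mathlib` only).  Companion prose: HOME/CITED-FACTS.md
§pub-hodgecm-cf-kudla-howe-rallis KHR-10…KHR-13 and HOME/GAPS.md pv14-G1 (the PerL ↔ Liu dictionary, by pv14).
-/
import Mathlib

set_option autoImplicit false

/-!
# Cited: the Albanese of unitary Shimura varieties (Yifeng Liu, Cambridge J. Math. 9 (2021) 1–147, §4)

The one load-bearing input of PerL v5 that had no print home under the cell's ABSOLUTE RULE is the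
"automorphic dictionary" of PerL §1.4 / Prop 2.3 (node N02/N05): `[Y1neg] Lemma 4.1` (the Hecke character `μ(π)`),
`Thm 8.1(a)` (every `π ∈ 𝒜^{1,0}` is a theta lift from a hermitian line, `m(π) = 1`) and `Prop 6.2 = (eq:Na)`
(`N(a) ≅ (H¹(B*_{Φ'(π)}, ℚ) ⊗_{L*} T'_a)^{⊕ d_a}`) — GAPS.md adv4-O1 / adv1-O3.  pv14 (GAPS.md pv14-G1, 03:45Z) located
the published source in PerL's generality (`E/F` any CM extension, `n = 3`, Compact Case): Yifeng Liu, *Fourier–Jacobi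
cycles and arithmetic relative trace formula* (with an appendix by Chao Li and Yihang Zhu), Cambridge J. Math. **9**
(2021), no. 1, 1–147 = arXiv:2102.11518 [Liu21], §4.2 "Albanese of unitary Shimura varieties": Prop 4.13, Thm 4.15,
Thm 4.18, Cor 4.20.  This file types those statements in the style of `ThetaCorrespondence.lean`: each is a
`def <Name> (D : LiuAlbaneseDatum) : Prop` over BARE CARRIERS; nothing is asserted; the docstrings carry the statements
AS PRINTED (read in the held arXiv TeX, chunks p0018–p0023; the TeX extraction drops some macros — in v1/v2 the
symbols restored in ⟦·⟧ were the reader's; v3 resolves every one of them against the author's TeX source, next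
paragraph, and the quotations below now carry the source's own symbols), the typing dictionary, and what is NOT typed.

v3 (2026-08-18, gen-4 seat `literature-prover-pub-hodgecm-cf-kudla-howe-rallis-g4-0`; DOCSTRING-ONLY, every declaration
byte-identical to v2): the ⟦·⟧ restorations were CHECKED AGAINST THE AUTHOR'S TeX SOURCE with macros intact (arXiv
e-print `https://arxiv.org/e-print/2102.11518`, file `FJcycle.tex` dated 2021-06-19, read-only GET; copy and a §4.1–4.2
extract with line numbers filed at `HOME/pub-hodgecm-cf-kudla-howe-rallis-g4/lit/Liu21-arxiv-src/`).  Result, macro by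
macro (FJcycle.tex line numbers): ⟦w⟧ = `\tw` = `\mathtt{w}` (l. 453), index set ⟦Σ⟧_F = `\Phi_F` := "the set of real
embeddings of `F`" (l. 1888); ⟦arg⟧ = `\arg`; ⟦alg⟧ = `\alg` (roman); Def 4.5 ⟦N'⟧_μ(x) = `\eta_\mu(x)` with (Def 4.5(1),
l. 1939–1942) "We denote by `η'_μ : Res_{M'_μ/ℚ}𝔾_m → Res_{E/ℚ}𝔾_m` the reciprocity map, and put `η_μ := η'_μ ∘
Nm_{M_μ/M'_μ} : Res_{M_μ/ℚ}𝔾_m → Res_{E/ℚ}𝔾_m`" (so 'the reflex norm' of v1/v2 is, precisely, the reflex norm of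
`(M'_μ, ·)` precomposed with the norm `M_μ → M'_μ`); ⟦𝒟⟧(μ) = `\cA(\mu)` = `𝒜(μ)`, "the category of CM data for `μ`"
(Def 4.5(3)); ⟦Gal⟧(ℂ/M_μ) = `\Gal(\dC/M_\mu)`; ⟦Aut(ℂ/ℚ)⟧-orbits = `\Gal(\dC/\dQ)`-orbits (Liu's notation for
`Aut(ℂ/ℚ)`, l. 664 / l. 2307); `A_K^⟦end⟧` = `A_K^{\r{end}}`; [⟦GR⟧91] = `\cites{GR91,Rog92}`.  Every quoted
STATEMENT (Def 4.1/4.3/4.5/4.11/4.12, Prop 4.13, Remark 4.14, Thm 4.15, Def 4.16, Thm 4.18, Cor 4.20) was re-read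
in the source and is word-identical to the quotation below; one clause elided in v1 is restored in place (Def 4.3(2)
ends ", with the induced CM type `Ψ_μ`"; Remark 4.4: "`Ψ_{μ^c}` is the opposite CM type of `Ψ_μ`").  The theorem
NUMBERS are those of the compiled arXiv version (held extraction `paper:arxiv-2102.11518`: 'Proposition 4.13.'
p0020 L53, 'Theorem 4.18.' p0022 L59, 'Corollary 4.20.' p0023 L45); the published Cambridge J. Math. 9 (2021)
numbering is still unconfirmed (no open copy; acquisition acq-07613).

Setting of [Liu21, §4.2] (chunk p0019 L61–p0020 L27): `E/F` a CM extension, `n ≥ 2`, `𝕍` a totally positive definite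
INCOHERENT hermitian space over `𝔸_E` of rank `n`; `{Sh(𝕍)_K}_K` its unitary Shimura varieties over `E` (smooth,
quasi-projective, dimension `n − 1`; projective iff Compact Case, i.e. unless `d = [F:ℚ] = 1` …), `X_K` the (toroidal
compactification of, = itself in the Compact Case) `Sh(𝕍)_K`, `A_K := Alb(X_K)`, `A_∞ := lim_K A_K` with its Hecke
action of `U(𝕍)(𝔸_F^∞)`, `H¹_{B,τ'}(A_∞, ℂ) := colim_K H¹_{B,τ'}(A_K, ℂ)` "an admissible representation of
`U(𝕍)(𝔸_F^∞)`" for every embedding `τ' : E → ℂ`.  PerL's dictionary (pv14-G1): `E = L`, `F = L₀` (`[L₀:ℚ] ≥ 12`: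
Compact Case), `n = 3`, `𝕍` = the incoherent space agreeing with `V₃` at all finite places, `Sh(𝕍)_K ⊗_{E,ι₁} ℂ =
S(K_f)(ℂ)` (Liu Prop. 9.5 / App. C), allowed datum `(W_i, μ_i, χ'_i)` ↔ oscillator triple `(μ_i, ε(a_i), χ'_i)`.
-/

noncomputable section

universe u

namespace HodgeCM.Literature.Theta

/-- **Carriers for [Liu21, §4.1–4.2].**
* `Char` — the conjugate-symplectic automorphic characters `μ : E^×\𝔸_E^× → ℂ^×` of WEIGHT ONE.  AS PRINTED,
  Def 4.1 (chunk p0018 L25–27): "We say that an automorphic character `μ : E^×\𝔸_E^× → ℂ^×` is conjugate self-dual if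
  `μ` is trivial on `N_{𝔸_E/𝔸_F} 𝔸_E^×`. We say that `μ` is conjugate orthogonal (resp. conjugate symplectic) if
  `μ|_{𝔸_F^×} = 1` (resp. `μ|_{𝔸_F^×} = μ_{E/F}`)."; Remark 4.2 + Def 4.3 (p0018 L29–42): "For a conjugate symplectic
  (resp. conjugate orthogonal) automorphic character `μ`, there exist a CM type `Φ_μ` and a unique tuple
  `𝚠_μ = (𝚠_τ)_{τ ∈ Φ_F}` [v3: `\underline{\tw}_\mu=(\tw_\tau)_{\tau\in\Phi_F}`, `Φ_F` = the real embeddings of `F`] of odd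
  (resp. even) nonnegative integers such that for every `τ ∈ Φ_F`, the component `μ_τ :
  (E ⊗_{F,τ} ℝ)^× → ℂ^×` is the character `z ↦ arg(z)^{−𝚠_τ}`, where we have identified `(E ⊗_{F,τ} ℝ)^×` with `ℂ^×`
  via the unique element `τ' ∈ Φ_μ` above `τ`. If `𝚠_μ` does not contain `0`, then `Φ_μ` is also unique. …
  We call `𝚠_μ` the weight of `μ`. If `𝚠_μ` is a constant `m`, then we say that `μ` is of weight `m`. If `𝚠_μ` does
  not contain zero, then we call `Φ_μ` the CM type of `μ`. Furthermore, we denote by `M'_μ ⊆ ℂ` the reflex field of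
  `(E, Φ_μ)`, with the induced CM type `Ψ_μ`" [Remark 4.4, l. 1932: "`Ψ_{μ^c}` is the opposite CM type of `Ψ_μ`"];
  "`μ^{alg} := μ·|·|_E^{−1/2}`, which is then algebraic. Denote by `M_μ ⊆ ℂ` the subfield generated by values
  `μ^{alg}(x)` for `x ∈ (𝔸_E^∞)^×`, which is a
  number field containing `M'_μ`."
* `Adm μ` — the pairs `(ε, χ)` completing `μ` to an adèlic oscillator triple with `ε` `μ`-ADMISSIBLE.  AS PRINTED,
  Def 4.11 (p0020 L29–42): "An adèlic oscillator triple is a triple `(μ, ε, χ)` consisting of • a conjugate symplectic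
  automorphic character `μ = ⊗ μ_v` …, • a collection `ε = (ε_v ∈ E_v^{×,−}/N_{E_v/F_v} E_v^×)_v` for every
  nonarchimedean place `v` of `F` such that `ε_v ∈ 𝒪_{E_v}^× N_{E_v/F_v} E_v^×` for all but finitely many `v`, and •
  an automorphic character `χ = ⊗ χ_v : E¹\(𝔸_E^∞)¹ → ℂ^×` … the adèlic oscillator representation attached to
  `(μ, ε, χ)`, `ω(μ, ε, χ) := ⊗'_v ω(μ_v, ε_v, χ_v)`, which is an irreducible admissible representation of
  `U(𝕍)(𝔸_F^∞)`."; Def 4.12 (p0020 L44–51): "we say that `ε` is `μ`-admissible if there exists some `e ∈ E^{×,−}`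
  such that • `ε_v = e N_{E_v/F_v} E_v^×` for every nonarchimedean place `v` of `F`, and • `τ'(e)` has negative
  imaginary part for every `τ' ∈ Φ_μ`."
* `Rep` — isomorphism classes of irreducible admissible `ℂ[U(𝕍)(𝔸_F^∞)]`-modules; `omega μ a = ω(μ, ε, χ)`.
* `Emb` — embeddings `τ' : E → ℂ`; `H1mult τ' ρ` — the multiplicity of `ρ` in the admissible representation
  `H¹_{B,τ'}(A_∞, ℂ)` (well defined once Prop 4.13 makes it a direct sum of irreducibles).
* `Level` — sufficiently small open compact `K ⊆ U(𝕍)(𝔸_F^∞)`; `invDim ρ K = dim ρ^K`.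
* `Isog` — the Grothendieck monoid of abelian varieties over `E` up to isogeny (additively: `[A × B] = [A] + [B]`,
  free on the simple classes by Poincaré reducibility); `alb K = [A_K]`; `Amu μ = [A_μ]`, `A_μ` the CM abelian variety
  over `E` of Liu's CM data (Def 4.5 / Prop 4.6, p0018 L53 ff.: "`i_μ : M_μ → End_E(A_μ)_ℚ` is a CM structure such
  that … the determinant of the action of `i_μ(x)` on the `E`-vector space `Lie_E(A_μ)` equals `η_μ(x)`" [v3: `\eta_\mu`, with
  Def 4.5(1) "`η'_μ : Res_{M'_μ/ℚ}𝔾_m → Res_{E/ℚ}𝔾_m` the reciprocity map, `η_μ := η'_μ ∘ Nm_{M_μ/M'_μ}`" — the reflex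
  norm precomposed with the norm to the reflex field] "… the associated CM character of `A_μ` with respect to the
  inclusion `M_μ ↪ ℂ` coincides with `μ^{alg}`",
  existence/uniqueness up to isogeny by [Shi71] Thm 5/6 — Casselman's theorem); `isRep μ` — `μ` is the chosen
  representative of its `Gal(ℂ/ℚ)`-orbit (Cor 4.20; [v3: `\Gal(\dC/\dQ)` in the source = `Aut(ℂ/ℚ)`]); `d μ K = d(μ, K)`;
  `n` — the rank of `𝕍`. -/
structure LiuAlbaneseDatum where
  /-- weight-one conjugate-symplectic automorphic characters of `𝔸_E^×` -/
  Char : Type u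
  /-- `μ`-admissible completions `(ε, χ)` -/
  Adm : Char → Type u
  /-- irreducible admissible `U(𝕍)(𝔸_F^∞)`-modules up to isomorphism -/
  Rep : Type u
  /-- `ω(μ, ε, χ)` -/
  omega : (μ : Char) → Adm μ → Rep
  /-- embeddings `τ' : E → ℂ` -/
  Emb : Type u
  /-- multiplicity of `ρ` in `H¹_{B,τ'}(A_∞, ℂ)` -/
  H1mult : Emb → Rep → ℕ
  /-- levels `K` -/
  Level : Type u
  /-- `dim ρ^K` -/
  invDim : Rep → Level → ℕ
  /-- isogeny classes of abelian varieties over `E`, as an additive monoid -/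
  Isog : Type u
  [instIsog : AddCommMonoid Isog]
  /-- `[A_K] = [Alb X_K]` -/
  alb : Level → Isog
  /-- `[A_μ]` -/
  Amu : Char → Isog
  /-- orbit representatives -/
  isRep : Char → Prop
  /-- `d(μ, K)` -/
  d : Char → Level → ℕ
  /-- `n = rank 𝕍` -/
  n : ℕ

attribute [instance] LiuAlbaneseDatum.instIsog

namespace LiuAlbaneseDatum

variable (D : LiuAlbaneseDatum.{u})

/-- **[Liu21, Prop. 4.13]** (chunk p0020 L53–57), AS PRINTED: "Suppose that `n ≥ 3`. Then for every embedding
`τ' : E → ℂ`, there is an isomorphism `H¹_{B,τ'}(A_∞, ℂ) ≅ ⊕_{(μ,ε,χ)} ω(μ, ε, χ)` of `ℂ[U(𝕍)(𝔸_F^∞)]`-modules, where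
the direct sum is taken over all adèlic oscillator triples in which `μ` is of weight one and `ε` is `μ`-admissible."
Proof inputs named there: [MR92] Lemma 1 (Zucker), Matsushima, [BMM] Prop. 13.4 (poles of `L^S(s, π × μ)`), Liu's
Thm (th:pole) / Cor (co:pole2) (theta lifts from hermitian LINES, "always in Weil's convergent range", Rallis inner
product formula), Lemma (le:weil_arch); the proof shows "the dimension of `H¹_{B,τ'}(A_∞, ℂ)[ω(μ, ε, χ)]` is `1`".
Remark 4.14: "When `n = 3`, Proposition 4.13 can be deduced from [GR91, Rog92]." [v3: `\cites{GR91,Rog92}` =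
Gelbart–Rogawski 1991, Rogawski 1992]
TYPING: as the MULTIPLICITY statement for the admissible module `H¹_{B,τ'}(A_∞, ℂ)`: the multiplicity of an
irreducible `ρ` is the number of admissible weight-one triples `t` with `ω(t) ≅ ρ` (`Nat.card`, = 0 if that set were
infinite — it is finite, indeed a singleton or empty, by Thm 4.18 (2) and distinct central data for distinct `μ`).
This multiplicity reading of the printed direct-sum isomorphism USES that each summand `ω(μ, ε, χ)` is IRREDUCIBLE,
which is [Liu21, Def. 4.11] (chunk p0020 L38–42), AS PRINTED: "it makes sense to define the adèlic oscillator
representation attached to `(μ,ε,χ)`, `ω(μ,ε,χ) := ⊗'_v ω(μ_v,ε_v,χ_v)`, which is an irreducible admissible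
representation of `U(𝕍)(𝔸_F^∞)`" (referee 3, 03:50:30Z: say so explicitly, else the reading is a hair stronger
than the displayed isomorphism).
PerL USE: node N02/N05 — [Y1neg] Thm 8.1(a) ("every `π ∈ 𝒜^{1,0}` is a theta lift from a hermitian line, `m(π) = 1`")
and Lemma 4.1 (`μ(π)` well defined) are the `n = 3` case read at `τ' = ι₁` (PerL (P1) cites BMM Thm 7.8 / Cor 7.9 for
the first). -/
def Prop413 : Prop :=
  3 ≤ D.n → ∀ (τ' : D.Emb) (ρ : D.Rep),
    D.H1mult τ' ρ = Nat.card {t : (μ : D.Char) × D.Adm μ // D.omega t.1 t.2 = ρ}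

/-- **[Liu21, Thm 4.18 (2)]** (chunk p0022 L107–113), AS PRINTED (main statement and items): "There is an isomorphism
`Ω(μ) ⊗_{M_μ} ℂ ≅ ⊕_ε ⊕_χ ω(μ, ε, χ)` of `ℂ[U(𝕍)(𝔸_F^∞)]`-modules, where the direct sum is taken over all `ε, χ` such
that `ε` is `μ`-admissible. Moreover, (1) For every object `D_μ = (A_μ, i_μ, λ_μ, r_μ) ∈ 𝒜(μ)` [v3: `\cA(\mu)`, the category of CM data], we have a canonical
isomorphism `Ω(μ)^K ≅ Hom_E(A_K, A_μ)_ℚ` for every sufficiently small open compact subgroup `K ⊆ U(𝕍)(𝔸_F^∞)`.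
(2) The `ℂ[U(𝕍)(𝔸_F^∞)]`-modules in the direct sum … are mutually non-isomorphic. (3) For every given `ε` that is
`μ`-admissible, the subspace `⊕_χ ω(μ, ε, χ)` is stable under the action of `Gal(ℂ/M_μ)`."  with Def 4.16:
"`Ω(μ) := colim_{D_μ ∈ 𝒜(μ)} Hom_E(A_∞, A_μ)_ℚ` in the category of `M_μ[U(𝕍)(𝔸_F^∞)]`-modules".
TYPING: ONLY item (2) is typed (injectivity of `(ε, χ) ↦ ω(μ, ε, χ)` on admissible pairs); the main isomorphism and
(1), (3) need the `M_μ`-module `Ω(μ) = Hom(A_∞, A_μ)_ℚ`, i.e. the model's `Hom(Alb, B) ⊗ ℚ` (PerL Def 2.2's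
`ℋ_t`), and are RECORDED here, not typed (their typed home is the N05 holder's split of PerL Prop 2.3 over
`Universe.Uiso`).  PerL USE: (eq:Na) = [Y1neg] Prop 6.2 ⇐ Thm 4.18 + Cor 4.20 (pv14-G1 dictionary: `T'_a ⊇ L*_{Φ'}` ↔
`M_μ ⊇ M'_μ`, `B♮_a` ↔ simple factor of `A_μ`, `d_a` ↔ `d(μ,K)`); [Y1neg] L5.1/L5.2 ⇐ (2),(3) + Thm 4.15. -/
def Thm418_2 : Prop :=
  ∀ (μ : D.Char) (a b : D.Adm μ), D.omega μ a = D.omega μ b → a = b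

/-- **[Liu21, Cor. 4.20]** (chunk p0023 L45–55), AS PRINTED: "Take an arbitrary object `D_μ = (A_μ, i_μ, λ_μ, r_μ) ∈
𝒜(μ)`. For every sufficiently small open compact subgroup `K` of `U(𝕍)(𝔸_F^∞)`, there is an isogeny decomposition
`A_K ∼ ∏_μ A_μ^{d(μ,K)}`, resp. `A_K^{end} ∼ ∏_μ A_μ^{d(μ,K)}` of abelian varieties over `E` when `n ≥ 3` (resp.
`n = 2`), where the product is taken over representatives of `Gal(ℂ/ℚ)`-orbits [v3: `\Gal(\dC/\dQ)` in the author's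
source, FJcycle.tex l. 2307 — Liu's notation for `Aut(ℂ/ℚ)`, acting on `μ` through the values of `μ^{alg}`] of all conjugate symplectic
automorphic characters of `𝔸_E^×` of weight one. Here, `A_K^{end}` is the endoscopic part of `A_K` when `n = 2` …
and `d(μ, K) := Σ_ε Σ_χ dim ω(μ, ε, χ)^K`, where the sum is taken over all `ε, χ` such that `ε` is `μ`-admissible."
(= [Liu21, Thm 1.1], chunk p0004 L1–17.)
TYPING: in the isogeny monoid, `[A_K] = Σ_{μ representative} d(μ,K) • [A_μ]` (a `finsum`: finitely many `μ` have
`d(μ,K) ≠ 0`), and `d(μ,K) = Σ_{(ε,χ) admissible} dim ω(μ,ε,χ)^K` (a `finsum`: finitely many nonzero terms) — the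
`n ≥ 3` clause only (PerL: `n = 3`); the `n = 2` endoscopic variant is not typed.
PerL USE: this is the Albanese form of (eq:Na)/[Y1neg] Prop 6.2 and of PerL Def 2.2's isotypic decomposition
`H¹(S(K_f), ℚ) = ⊕_a N(a)`: `H¹(S(K_f)(ℂ), ℚ) = H¹(A_K(ℂ), ℚ) = ⊕_μ H¹(A_μ(ℂ), ℚ)^{d(μ,K)}` as ℚ-Hodge structures with
`M_μ`-action (pv14-G1).  MISMATCH / what the consumer must still do: identify `A_μ` (CM by `M_μ ⊇ M'_μ =` reflex field
of `(L, Φ_μ)`, CM character `μ^{alg}`) with a power of the simple CM abelian variety of REFLEX type — Liu's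
construction via [Shi71] gives it; and match `Φ_{μ_i}` with PerL's `Ψ_i` SIGN-EXACTLY (pv14-G1 caveat (iv)). -/
def Cor420 : Prop :=
  3 ≤ D.n →
    (∀ K : D.Level, D.alb K = ∑ᶠ μ : {μ : D.Char // D.isRep μ}, D.d μ.1 K • D.Amu μ.1) ∧
    ∀ (μ : D.Char) (K : D.Level), D.d μ K = ∑ᶠ a : D.Adm μ, D.invDim (D.omega μ a) K

variable {D}

/-- **Kernel-checked reading of Prop 4.13 + Thm 4.18 (2): multiplicity one.**  If distinct `μ` never give isomorphic
oscillator representations (true: `ω(μ,ε,χ)` determines `μ` through its local components — NOT printed as such in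
[Liu21]; carried here as the explicit hypothesis `hμ`), then every irreducible occurs in `H¹_{B,τ'}(A_∞, ℂ)` with
multiplicity `≤ 1` — PerL §1.4's "`m(π) = 1`" / [Y1neg] Thm 8.1(a), cf. Liu's proof "the dimension of
`H¹_{B,τ'}(A_∞,ℂ)[ω(μ,ε,χ)]` is 1". -/
theorem Prop413.mult_le_one (h : D.Prop413) (h2 : D.Thm418_2) (hn : 3 ≤ D.n)
    (hμ : ∀ (μ μ' : D.Char) (a : D.Adm μ) (b : D.Adm μ'), D.omega μ a = D.omega μ' b → μ = μ')
    (τ' : D.Emb) (ρ : D.Rep) : D.H1mult τ' ρ ≤ 1 := by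
  rw [h hn τ' ρ]
  haveI : Subsingleton {t : (μ : D.Char) × D.Adm μ // D.omega t.1 t.2 = ρ} := by
    refine ⟨fun x y => Subtype.ext ?_⟩
    obtain ⟨⟨μ, a⟩, hx⟩ := x
    obtain ⟨⟨μ', b⟩, hy⟩ := y
    have hμμ' : μ = μ' := hμ μ μ' a b (hx.trans hy.symm)
    subst hμμ'
    have hab : a = b := h2 μ a b (hx.trans hy.symm)
    subst hab
    rfl
  exact Finite.card_le_one_iff_subsingleton.mpr inferInstance

end LiuAlbaneseDatum

end HodgeCM.Literature.Theta

end
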